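import Mathlib
import HarnessLib
import Summits.NavierStokesRegularity.NavierStokesRegularity.Theorems.PoloidalWindowDoorLrcModEntireTwistingTHRidgeLaw
import Summits.NavierStokesRegularity.NavierStokesRegularity.Theorems.PoloidalWindowDoorLrcModEntireTwistingTHSlopeSign
import Summits.NavierStokesRegularity.NavierStokesRegularity.Theorems.PoloidalWindowDoorLrcModEntireTwistingTHNonflatPlane
import Summits.NavierStokesRegularity.NavierStokesRegularity.Theorems.PoloidalWindowDoorLrcModEntireRidgeWiring
import Summits.NavierStokesRegularity.NavierStokesRegularity.Theorems.PoloidalWindowDoorLrcModEntireThreadPressure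

/-!
# Item `LrcModEntire` (stmt-NavierStokesRegularity-20428) — THE RIDGE LAW FROM THE BINDER, pointwise on the hot set, in the nested-`fderiv` currency of BRANCH-PARAM

LEAD of item 20428 ns-poloidal-K2-p3 g15 (`--supports stmt-NavierStokesRegularity-20428 --as helper`).  The input `hlap` of `…RidgeGlobalBranch.exists_complete_hotBranch_of_ridge` /
`…RidgeGlobalBranchHullEntrance.exists_homogeneous_hullLimit_of_ridge` (BRANCH-PARAM, memo `Cruxes/LrcModEntire/T2B-g15.md`) discharged from clauses of `stub_T2b` VERBATIM: class
package, global (TH) `hTH`, hot-spot normalisation, and PROPERNESS of the ridge («the hot set has empty planar interior»).  Chain inside, all by name: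
properness at the hot spot ⇒ a non-flatness witness `∂_{c₁}v₂(−1,y₁) ≠ 0` (`…TwistingTHNonflatPlane.exists_fderiv_two_ne_zero_of_properRidge`) ⇒ a `C³` slope function `μ` near
`P₀` (`…TwistingTHSlopeFunction.exists_slopeFunction_near_plane`) with `μ(−1,0) ≠ 1` (`…TwistingTHSlopeSign.slopeRatio_ne_one`: `μ₀ ≤ 0` ALWAYS) ⇒ the ridge law
`…TwistingTHRidgeLaw.horizLaplacian_two_eq_of_hotPoints` (`Δₕv₂(−1,·)` constant on the hot set), converted by `…RidgeWiring.fderiv_fderiv_eq_coord`; the sign `κ ≥ 0` from the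
Hessian pin at the hot spot (`…ThreadPressure.threadHessianPin`).

* `exists_ridgeLaw_nested` — **∃ κ ≥ 0, ∀ y ∈ H: `D²(σv₂(−1,·))(y)[e₀,e₀] + D²(σv₂(−1,·))(y)[e₁,e₁] = −κ`** (`σ` the sign of `N = v₂(−1,0)`).  The dichotomy `κ = 0` (flat ridge,
  sub-cell T2b-flat) / `κ > 0` (non-degenerate: BRANCH-PARAM ⇒ research cell (Q4)) is therefore read off the binder.

WHAT THIS IS NOT: not a claim about Navier–Stokes regularity and not a proof of `stub_T2b` (bears_on LADDER-NS N0, item 20428 / crux 19708; 20428/19708/27893 OPEN).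
-/

set_option linter.style.longLine false
set_option linter.dupNamespace false

namespace Summit.NavierStokesRegularity.NavierStokesRegularity.Theorems.PoloidalWindowDoorLrcModEntireTwistingTHRidgeLawNested

open Set Function Filter Topology Metric
open scoped RealInnerProductSpace InnerProductSpace ContDiff
open Literature.Analysis Literature.Analysis.FluidPDE Literature.Analysis.UnboundedOperators
open Summit.NavierStokesRegularity.NavierStokesRegularity.Theorems
open Summit.NavierStokesRegularity.NavierStokesRegularity.Theorems.LocalSineTubeDoorProfileAlignedWindowRigidityAncient
open Summit.NavierStokesRegularity.NavierStokesRegularity.Theorems.PoloidalWindowDoorLrcModEntireTwistingTHRidgeLaw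
open Summit.NavierStokesRegularity.NavierStokesRegularity.Theorems.PoloidalWindowDoorLrcModEntireTwistingTHSlopeSign
open Summit.NavierStokesRegularity.NavierStokesRegularity.Theorems.PoloidalWindowDoorLrcModEntireTwistingTHSlopeFunction
open Summit.NavierStokesRegularity.NavierStokesRegularity.Theorems.PoloidalWindowDoorLrcModEntireTwistingTHNonflatPlane
open Summit.NavierStokesRegularity.NavierStokesRegularity.Theorems.PoloidalWindowDoorLrcModEntireRidgeWiring
open Summit.NavierStokesRegularity.NavierStokesRegularity.Theorems.PoloidalWindowDoorLrcModEntireThreadPressure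

variable {C : ℝ} {v : ℝ → EuclideanSpace ℝ (Fin 3) → EuclideanSpace ℝ (Fin 3)}

/-- **THE RIDGE LAW FROM THE BINDER, nested currency.**  See the module docstring. -/
theorem exists_ridgeLaw_nested (hdec : HasTypeITimeDecay C v) (hcont : ContinuousOn (uncurry v) (Iio (0 : ℝ) ×ˢ univ))
    (hmild : ∀ s t : ℝ, s < t → t < 0 → ∀ x, v t x = heatExtension (v s) (t - s) x - oseenDuhamel 1 s v v t x)
    (hdiv : ∀ t < 0, VectorCalculus.IsDivFree (v t))
    (hpol : ∀ s < 0, ∀ y, ⟪curl (v s) y, EuclideanSpace.single 2 1⟫_ℝ = 0)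
    (hTH : ∀ t < 0, ∀ x x' : EuclideanSpace ℝ (Fin 3), x 2 = x' 2 → ∀ b c : Fin 3, b ≠ 2 → c ≠ 2 →
      fderiv ℝ (v t) x (EuclideanSpace.single 2 1) b * fderiv ℝ (v t) x' (EuclideanSpace.single c 1) 2 =
        fderiv ℝ (v t) x' (EuclideanSpace.single 2 1) c * fderiv ℝ (v t) x (EuclideanSpace.single b 1) 2)
    (hne : v (-1) 0 2 ≠ 0) (hhot : ∀ t < 0, ∀ x, Real.sqrt (-t) * |v t x 2| ≤ |v (-1) 0 2|)
    (hproper : ∀ y ∈ {y : EuclideanSpace ℝ (Fin 3) | y 2 = 0 ∧ v (-1) y 2 = v (-1) 0 2}, ∀ r : ℝ, 0 < r →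
      ∃ y' : EuclideanSpace ℝ (Fin 3), y' 2 = 0 ∧ dist y' y < r ∧ v (-1) y' 2 ≠ v (-1) 0 2)
    {σ : ℝ} (hσN : σ * v (-1) 0 2 = |v (-1) 0 2|) :
    ∃ κ : ℝ, 0 ≤ κ ∧ ∀ y : EuclideanSpace ℝ (Fin 3), y 2 = 0 → v (-1) y 2 = v (-1) 0 2 →
      fderiv ℝ (fderiv ℝ (fun x => σ * v (-1) x 2)) y (EuclideanSpace.single 0 1) (EuclideanSpace.single 0 1) +
        fderiv ℝ (fderiv ℝ (fun x => σ * v (-1) x 2)) y (EuclideanSpace.single 1 1) (EuclideanSpace.single 1 1) = -κ := by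
  have h1 : (-1 : ℝ) < 0 := by norm_num
  have h02 : (0 : EuclideanSpace ℝ (Fin 3)) 2 = 0 := rfl
  -- slice regularity
  have hslice_an : AnalyticOnNhd ℝ (v (-1)) univ := analyticOnNhd_slice hcont (bdd_of_hasTypeITimeDecay hdec) hmild h1
  have hslice : ContDiff ℝ ∞ (v (-1)) := contDiffOn_univ.1 hslice_an.contDiffOn_of_completeSpace
  set θ : EuclideanSpace ℝ (Fin 3) → ℝ := fun y => v (-1) y 2 with hθdef
  set f : EuclideanSpace ℝ (Fin 3) → ℝ := fun y => σ * v (-1) y 2 with hfdef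
  have hθan : AnalyticOnNhd ℝ θ univ := fun y hy => ((EuclideanSpace.proj (𝕜 := ℝ) (2 : Fin 3)).analyticAt _).comp (hslice_an y hy)
  have hθ : ContDiff ℝ 2 θ := hθan.contDiff.of_le le_top
  have hfθ : f = σ • θ := by funext y; simp [hfdef, hθdef, smul_eq_mul]
  have hf : ContDiff ℝ 2 f := by rw [hfθ]; exact hθ.const_smul σ
  -- second derivatives of `f` are `σ` times the coordinate-nested ones of `θ`
  have hD2 : ∀ y u w, fderiv ℝ (fderiv ℝ f) y u w = σ * fderiv ℝ (fun x => fderiv ℝ θ x w) y u := by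
    intro y u w
    rw [fderiv_fderiv_eq_coord hf]
    have e1 : (fun x => fderiv ℝ f x w) = fun x => σ * fderiv ℝ θ x w := by
      funext x
      rw [hfθ, fderiv_const_smul ((hθ.differentiable (by norm_num)) x) σ]
      simp [smul_eq_mul]
    rw [e1]
    have hdw : DifferentiableAt ℝ (fun x => fderiv ℝ θ x w) y :=
      (((hθ.fderiv_right (m := 1) (by norm_num)).differentiable one_ne_zero).clm_apply (differentiable_const w)) y
    rw [show (fun x => σ * fderiv ℝ θ x w) = σ • (fun x => fderiv ℝ θ x w) by funext x; simp [smul_eq_mul], fderiv_const_smul hdw σ]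
    simp [smul_eq_mul]
  -- ## the slope function with `μ₀ ≠ 1` (properness at the hot spot ⇒ non-flat thread plane)
  obtain ⟨y', hy'2, -, hy'ne⟩ := hproper 0 ⟨h02, rfl⟩ 1 one_pos
  obtain ⟨y₁, hy₁, c₁, hc₁, hne₁⟩ :=
    exists_fderiv_two_ne_zero_of_properRidge (hslice.differentiable (by simp)) ⟨y', hy'2, hy'ne⟩
  obtain ⟨μ, hμ, hslope, hμ0⟩ := exists_slopeFunction_near_plane hdec hcont hmild hTH hy₁ hc₁ hne₁
  have hμ1 : μ (-1) 0 ≠ 1 := by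
    rw [hμ0, Ne, div_eq_one_iff_eq hne₁]
    exact slopeRatio_ne_one hdec hcont hmild hdiv hpol hTH hne hhot hy₁ hc₁ hne₁
  -- ## the constant `κ := −(σ Δₕθ)(0)` and its sign
  set κ : ℝ := -(fderiv ℝ (fderiv ℝ f) 0 (EuclideanSpace.single 0 1) (EuclideanSpace.single 0 1) +
    fderiv ℝ (fderiv ℝ f) 0 (EuclideanSpace.single 1 1) (EuclideanSpace.single 1 1)) with hκ
  have hsign : ∀ w : EuclideanSpace ℝ (Fin 3), fderiv ℝ (fderiv ℝ f) 0 w w ≤ 0 := by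
    intro w
    have hpin := threadHessianPin hdec hcont hmild hne hhot w
    rw [iteratedFDeriv_two_apply] at hpin
    simp only [Matrix.cons_val_zero, Matrix.cons_val_one] at hpin
    -- `N · D²θ(0)[w,w] ≤ 0` and `σN = |N| > 0` ⇒ `σ · D²θ(0)[w,w] ≤ 0`
    have hNpos : 0 < |v (-1) 0 2| := abs_pos.2 hne
    have hσθ : fderiv ℝ (fderiv ℝ f) 0 w w = σ * fderiv ℝ (fderiv ℝ θ) 0 w w := by
      rw [hD2, ← fderiv_fderiv_eq_coord hθ]
    rw [hσθ]
    have hkey : σ * fderiv ℝ (fderiv ℝ θ) 0 w w * |v (-1) 0 2| ≤ 0 := by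
      rw [← hσN]
      have : σ * fderiv ℝ (fderiv ℝ θ) 0 w w * (σ * v (-1) 0 2) = σ ^ 2 * (v (-1) 0 2 * fderiv ℝ (fderiv ℝ θ) 0 w w) := by ring
      rw [this]
      exact mul_nonpos_of_nonneg_of_nonpos (sq_nonneg σ) hpin
    by_contra hcon
    push Not at hcon
    have := mul_pos hcon hNpos
    linarith
  refine ⟨κ, ?_, fun y hy0 hy => ?_⟩
  · have h0 := hsign (EuclideanSpace.single 0 1)
    have h1' := hsign (EuclideanSpace.single 1 1)
    rw [hκ]; linarith
  · have hL := horizLaplacian_two_eq_of_hotPoints hdec hcont hmild hdiv hpol hμ hslope hμ1 hne hhot hy0 h02 hy rfl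
    rw [hκ, hD2, hD2, hD2, hD2, neg_neg]
    simp only [hθdef] at hL ⊢
    linear_combination σ * hL

end Summit.NavierStokesRegularity.NavierStokesRegularity.Theorems.PoloidalWindowDoorLrcModEntireTwistingTHRidgeLawNested
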